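import Summits.ResolutionOfSingularities.ResolutionOfSingularities.Theorems.FrobeniusClosingPatchingRelPerfectConeDepthLineRung
import HarnessLib

/-!
# Crux `PatchingRelPerfect` (stmt-ResolutionOfSingularities-16161), chain W5.2 — RUNG «r-binary-disc-ℓ», GENERAL LEADING
# COEFFICIENTS: every binary form `a₀x₀² + b x₀x₁ + a₁x₁²` with unit discriminant `b² − 4a₀a₁`, at every depth

[OURS · L1 W5.2 · rung tool] Replaces the role of NO printed item; NOT a statement of the manuscript under review; fact-free,
any characteristic, any residue field.  AI-written (AI review is weaker than expert review).

Reduction to the monic rung `binaryDiscRung_of_ringKrullDim` by a change of the regular system of parameters: if `a₀` is a unit,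
scale (`(q) = (a₀⁻¹q)`); if `a₁` is a unit, swap `x₀ ↔ x₁`; if neither is, `b` is a unit and the shear `x₁ ↦ x₁ − x₀` makes the
leading coefficient `a₀ + b + a₁` a unit (the discriminant is unchanged).  Core dress `atomDimFourBlowupAt_binaryForm`.

## References
* J. Kollár, *Lectures on Resolution of Singularities* (2007), 3.61. [Kollar2007]
* The Stacks Project, Tag 080A. [StacksProject]
-/

set_option linter.dupNamespace false

noncomputable section

open CategoryTheory CategoryTheory.Limits AlgebraicGeometry TopologicalSpace IsLocalRing
open Literature.AlgebraicGeometry.Resolution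
open Scheme.IdealSheafData
open scoped Pointwise

namespace Summit.ResolutionOfSingularities.ResolutionOfSingularities.Theorems

universe u

namespace ConeDepth

section Algebra

variable {S : Type u} [CommRing S]

/-- Scaling a binary form by the inverse of its unit leading coefficient does not change the ideal. [folklore] -/
theorem span_binaryForm_scale (a₀ v b a₁ x₀ x₁ : S) (h1 : a₀ * v = 1) :
    Ideal.span {a₀ * (x₀ * x₀) + b * (x₀ * x₁) + a₁ * (x₁ * x₁)} =
      Ideal.span {x₀ * x₀ + b * v * (x₀ * x₁) + a₁ * v * (x₁ * x₁)} := by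
  have h : a₀ * (x₀ * x₀) + b * (x₀ * x₁) + a₁ * (x₁ * x₁) = a₀ * (x₀ * x₀ + b * v * (x₀ * x₁) + a₁ * v * (x₁ * x₁)) := by
    linear_combination (-(b * (x₀ * x₁) + a₁ * (x₁ * x₁))) * h1
  rw [h, Ideal.span_singleton_mul_left_unit (IsUnit.of_mul_eq_one v h1)]

/-- The discriminant of the scaled form is `v²` times the old one. [folklore] -/
theorem disc_binaryForm_scale (a₀ v b a₁ : S) (h1 : a₀ * v = 1) :
    (b * v) ^ 2 - 4 * (a₁ * v) = v * v * (b ^ 2 - 4 * a₀ * a₁) := by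
  linear_combination (4 * a₁ * v) * h1

end Algebra

section General

variable {S : Type u} [CommRing S] [IsRegularLocalRing S]
  (x : Fin 4 → S) (hx : Ideal.span (Set.range x) = maximalIdeal S) (hdim : ringKrullDim S = (4 : ℕ)) (ℓ : ℕ)

include hx hdim in
/-- **Unit leading coefficient**: `a₀x₀² + b x₀x₁ + a₁x₁²` with `a₀ ∈ S×` and `b² − 4a₀a₁ ∈ S×` — scale to the monic rung.
[cite: Kollar2007, 3.61] -/
theorem binaryFormRung_of_isUnit (a₀ b a₁ : S) (hu : IsUnit a₀) (hD : IsUnit (b ^ 2 - 4 * a₀ * a₁)) :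
    (∃ (Q : Ideal S) (m : ℕ), IsLocalRing.maximalIdeal S ^ m ≤ Q ∧
      ∃ (B' : Scheme.{u}) (β : B' ⟶ Spec (.of S)),
        IsBlowup β (affineBlowup.idealSheaf
          ((Ideal.span {a₀ * (x 0 * x 0) + b * (x 0 * x 1) + a₁ * (x 1 * x 1)} ⊔ maximalIdeal S ^ (ℓ + 2)) * Q)) ∧
        Scheme.IsRegular B') ∧
    (∀ (T : Scheme.{u}) (f : T ⟶ Spec (.of S)),
      IsBlowup f (affineBlowup.idealSheaf
        (Ideal.span {a₀ * (x 0 * x 0) + b * (x 0 * x 1) + a₁ * (x 1 * x 1)} ⊔ maximalIdeal S ^ (ℓ + 2))) →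
      ∃ (J : T.IdealSheafData) (T' : Scheme.{u}) (π : T' ⟶ T), J ≠ ⊥ ∧
        (∀ t : T, t ∈ J.support → f.base t = IsLocalRing.closedPoint S) ∧
        IsBlowup π J ∧ Scheme.IsRegular T') := by
  obtain ⟨v, h1⟩ := hu.exists_right_inv
  have hv : IsUnit v := IsUnit.of_mul_eq_one_right a₀ h1
  have hD' : IsUnit ((b * v) ^ 2 - 4 * (a₁ * v)) := by
    rw [disc_binaryForm_scale a₀ v b a₁ h1]
    exact (hv.mul hv).mul hD
  rw [span_binaryForm_scale a₀ v b a₁ (x 0) (x 1) h1]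
  exact binaryDiscRung_of_ringKrullDim x hx hdim (a₁ * v) (b * v) hD' ℓ

include hx hdim in
/-- **RUNG «r-binary-disc-ℓ», GENERAL FORM**: for `S` regular local of dimension `4`, `x` spanning `𝔪`, and ANY binary form
`q = a₀x₀² + b x₀x₁ + a₁x₁²` with unit discriminant `b² − 4a₀a₁`, at EVERY depth `ℓ`: `(q) + 𝔪^{ℓ+2} ∈ 𝒞` and the blow-up-form
core conclusion holds (scale / swap / shear to the monic rung). [cite: Kollar2007, 3.61] [cite: StacksProject, Tag 080A] -/
theorem binaryFormRung_of_ringKrullDim (a₀ b a₁ : S) (hD : IsUnit (b ^ 2 - 4 * a₀ * a₁)) :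
    (∃ (Q : Ideal S) (m : ℕ), IsLocalRing.maximalIdeal S ^ m ≤ Q ∧
      ∃ (B' : Scheme.{u}) (β : B' ⟶ Spec (.of S)),
        IsBlowup β (affineBlowup.idealSheaf
          ((Ideal.span {a₀ * (x 0 * x 0) + b * (x 0 * x 1) + a₁ * (x 1 * x 1)} ⊔ maximalIdeal S ^ (ℓ + 2)) * Q)) ∧
        Scheme.IsRegular B') ∧
    (∀ (T : Scheme.{u}) (f : T ⟶ Spec (.of S)),
      IsBlowup f (affineBlowup.idealSheaf
        (Ideal.span {a₀ * (x 0 * x 0) + b * (x 0 * x 1) + a₁ * (x 1 * x 1)} ⊔ maximalIdeal S ^ (ℓ + 2))) →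
      ∃ (J : T.IdealSheafData) (T' : Scheme.{u}) (π : T' ⟶ T), J ≠ ⊥ ∧
        (∀ t : T, t ∈ J.support → f.base t = IsLocalRing.closedPoint S) ∧
        IsBlowup π J ∧ Scheme.IsRegular T') := by
  classical
  by_cases h0 : IsUnit a₀
  · exact binaryFormRung_of_isUnit x hx hdim ℓ a₀ b a₁ h0 hD
  by_cases h1 : IsUnit a₁
  · -- swap `x₀ ↔ x₁`
    have hx' : Ideal.span (Set.range (x ∘ Equiv.swap (0 : Fin 4) 1)) = maximalIdeal S := by
      rw [(Equiv.swap (0 : Fin 4) 1).surjective.range_comp]; exact hx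
    have hq : a₀ * (x 0 * x 0) + b * (x 0 * x 1) + a₁ * (x 1 * x 1) =
        a₁ * ((x ∘ Equiv.swap (0 : Fin 4) 1) 0 * (x ∘ Equiv.swap (0 : Fin 4) 1) 0) +
          b * ((x ∘ Equiv.swap (0 : Fin 4) 1) 0 * (x ∘ Equiv.swap (0 : Fin 4) 1) 1) +
          a₀ * ((x ∘ Equiv.swap (0 : Fin 4) 1) 1 * (x ∘ Equiv.swap (0 : Fin 4) 1) 1) := by
      simp only [Function.comp_apply, Equiv.swap_apply_left, Equiv.swap_apply_right]
      ring
    have hD' : IsUnit (b ^ 2 - 4 * a₁ * a₀) := by rwa [mul_right_comm]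
    rw [hq]
    exact binaryFormRung_of_isUnit _ hx' hdim ℓ a₁ b a₀ h1 hD'
  · -- shear `x₁ ↦ x₁ − x₀`: the leading coefficient becomes `a₀ + b + a₁`, a unit
    have hm0 : a₀ ∈ maximalIdeal S := (IsLocalRing.mem_maximalIdeal _).mpr h0
    have hm1 : a₁ ∈ maximalIdeal S := (IsLocalRing.mem_maximalIdeal _).mpr h1
    have hb2 : IsUnit (b ^ 2) := by
      by_contra hnu
      have hb2m : b ^ 2 ∈ maximalIdeal S := (IsLocalRing.mem_maximalIdeal _).mpr hnu
      have hmem : b ^ 2 - 4 * a₀ * a₁ ∈ maximalIdeal S :=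
        Ideal.sub_mem _ hb2m (Ideal.mul_mem_right _ _ (Ideal.mul_mem_left _ _ hm0))
      exact (IsLocalRing.mem_maximalIdeal _).mp hmem hD
    have hb : IsUnit b := (isUnit_pow_iff two_ne_zero).mp hb2
    have hlead : IsUnit (a₀ + b + a₁) := by
      by_contra hnu
      have hm : a₀ + b + a₁ ∈ maximalIdeal S := (IsLocalRing.mem_maximalIdeal _).mpr hnu
      have hbm : b ∈ maximalIdeal S := by
        have : b = (a₀ + b + a₁) - a₀ - a₁ := by ring
        rw [this]
        exact Ideal.sub_mem _ (Ideal.sub_mem _ hm hm0) hm1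
      exact (IsLocalRing.mem_maximalIdeal _).mp hbm hb
    set x' : Fin 4 → S := Function.update x 1 (x 1 - x 0) with hx'def
    have hx'0 : x' 0 = x 0 := Function.update_of_ne (by decide) _ _
    have hx'1 : x' 1 = x 1 - x 0 := Function.update_self _ _ _
    have hx'i : ∀ i, i ≠ 1 → x' i = x i := fun i hi => Function.update_of_ne hi _ _
    have hx' : Ideal.span (Set.range x') = maximalIdeal S := by
      rw [← hx]
      apply le_antisymm
      · rw [Ideal.span_le]
        rintro _ ⟨i, rfl⟩
        by_cases hi : i = 1
        · subst hi
          rw [SetLike.mem_coe, hx'1]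
          exact Ideal.sub_mem _ (Ideal.subset_span ⟨1, rfl⟩) (Ideal.subset_span ⟨0, rfl⟩)
        · rw [SetLike.mem_coe, hx'i i hi]
          exact Ideal.subset_span ⟨i, rfl⟩
      · rw [Ideal.span_le]
        rintro _ ⟨i, rfl⟩
        by_cases hi : i = 1
        · subst hi
          have h : x 1 = x' 1 + x' 0 := by rw [hx'1, hx'0]; ring
          rw [SetLike.mem_coe, h]
          exact Ideal.add_mem _ (Ideal.subset_span ⟨1, rfl⟩) (Ideal.subset_span ⟨0, rfl⟩)
        · rw [SetLike.mem_coe, ← hx'i i hi]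
          exact Ideal.subset_span ⟨i, rfl⟩
    have hq : a₀ * (x 0 * x 0) + b * (x 0 * x 1) + a₁ * (x 1 * x 1) =
        (a₀ + b + a₁) * (x' 0 * x' 0) + (b + (a₁ + a₁)) * (x' 0 * x' 1) + a₁ * (x' 1 * x' 1) := by
      rw [hx'0, hx'1]; ring
    have hD' : IsUnit ((b + (a₁ + a₁)) ^ 2 - 4 * (a₀ + b + a₁) * a₁) := by
      have h : (b + (a₁ + a₁)) ^ 2 - 4 * (a₀ + b + a₁) * a₁ = b ^ 2 - 4 * a₀ * a₁ := by ring
      rw [h]; exact hD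
    rw [hq]
    exact binaryFormRung_of_isUnit x' hx' hdim ℓ _ _ _ hlead hD'

end General

/-- **The registered core's binder shape on the member `(a₀x₀² + b x₀x₁ + a₁x₁²) + 𝔪^{ℓ+2}`** for ANY binary form with unit
discriminant `b² − 4a₀a₁` (hypotheses of `stub_atomDimFourBlowup`; characteristic, completeness, perfectness of the residue field
and the off-fibre hypothesis unused). [cite: Kollar2007, 3.61] -/
theorem atomDimFourBlowupAt_binaryForm (p : ℕ) (_hp : p.Prime) (S : Type) [CommRing S]
    [IsRegularLocalRing S] [CharP S p] [IsAdicComplete (IsLocalRing.maximalIdeal S) S]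
    [PerfectField (IsLocalRing.ResidueField S)] (hS : ringKrullDim S = (4 : ℕ))
    (x : Fin 4 → S) (hx : Ideal.span (Set.range x) = IsLocalRing.maximalIdeal S)
    (a₀ b a₁ : S) (hD : IsUnit (b ^ 2 - 4 * a₀ * a₁)) (ℓ : ℕ)
    (T : Scheme.{0}) (f : T ⟶ Spec (.of S))
    (hf : IsBlowup f (affineBlowup.idealSheaf
      (Ideal.span {a₀ * (x 0 * x 0) + b * (x 0 * x 1) + a₁ * (x 1 * x 1)} ⊔ IsLocalRing.maximalIdeal S ^ (ℓ + 2))))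
    (_hoff : ∀ t : T, f.base t ≠ IsLocalRing.closedPoint S → IsRegularLocalRing (T.presheaf.stalk t)) :
    ∃ (J : T.IdealSheafData) (T' : Scheme.{0}) (π : T' ⟶ T), J ≠ ⊥ ∧
      (∀ t : T, t ∈ J.support → f.base t = IsLocalRing.closedPoint S) ∧
      IsBlowup π J ∧ Scheme.IsRegular T' :=
  (binaryFormRung_of_ringKrullDim x hx hS ℓ a₀ b a₁ hD).2 T f hf

end ConeDepth

end Summit.ResolutionOfSingularities.ResolutionOfSingularities.Theorems

end
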